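import Summits.SmoothPoincare4.SmoothPoincare4.Theorems.SullivanDualWitnessChargeDefs

/-!
# Uniqueness of families of members on connected domains (UNIQ)

Crux `WitnessCharge` (stmt-SmoothPoincare4-7824), line `Sketch`, skeleton v7, stub `helper_familyUnique`.

Purely topological consequence of the universality half of the local chart `A'` of the moduli
space of pencil members: two families `F₁, F₂` of members over an open preconnected set `D ⊆ ℂ` of
intercepts, continuous as maps `(b, ξ) ↦ Fᵢ b ξ` on `D × ℂ`, which agree at one intercept agree on
all of `D`. The coincidence set `E = {b ∈ D | F₁ b = F₂ b}` is

* closed in `D`: for fixed `ξ` the maps `b ↦ Fᵢ b ξ` are continuous on `D` and agree on `E`, hence at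
  every point of `closure E ∩ D` (uniqueness of limits in the Hausdorff space `Σ ∖ p`);
* open: at `b₁ ∈ E` the chart of `A'` at the member `F₁ b₁ = F₂ b₁` provides `δ, Floc, r₀, V`; by the
  generalized tube lemma (compactness of `{b₁} × closedBall 0 r₀`) the graphs of `Fᵢ b` over the
  disc `‖ξ‖ ≤ r₀` stay in the open set `V` for `b` near `b₁`, so universality gives
  `F₁ b = Floc b = F₂ b`;

and the clopen argument `IsPreconnected.subset_of_closure_inter_subset` concludes.
-/

noncomputable section

set_option linter.dupNamespace false

open scoped Manifold ContDiff Topology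
open Set Filter Literature.Geometry.Kaehler Literature.Geometry.Symplectic
  Literature.Topology.FourManifolds

namespace Summit.SmoothPoincare4.SmoothPoincare4.Theorems.WitnessCharge.PencilIncompleteness

/-- Tube step: if `(b, ξ) ↦ F b ξ` is continuous on `D × ℂ` (`D` open, `b₁ ∈ D`) and the graph of
`F b₁` lies in the open set `V`, then for `b ∈ D` close to `b₁` the graph of `F b` over the closed
disc `‖ξ‖ ≤ r₀` lies in `V` (generalized tube lemma for the compact set `{b₁} × closedBall 0 r₀`). -/
theorem familyUnique_tube {Y : Type*} [TopologicalSpace Y] {D : Set ℂ} (hD : IsOpen D)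
    {F : ℂ → ℂ → Y} (hc : ContinuousOn (fun q : ℂ × ℂ => F q.1 q.2) (D ×ˢ (univ : Set ℂ)))
    {V : Set (ℂ × Y)} (hV : IsOpen V) {b₁ : ℂ} (hb₁ : b₁ ∈ D)
    (hgraph : ∀ ξ : ℂ, (ξ, F b₁ ξ) ∈ V) (r₀ : ℝ) :
    ∃ η : ℝ, 0 < η ∧ ∀ b ∈ D, dist b b₁ < η → ∀ ξ : ℂ, ‖ξ‖ ≤ r₀ → (ξ, F b ξ) ∈ V := by
  have hg : ContinuousOn (fun q : ℂ × ℂ => ((q.2, F q.1 q.2) : ℂ × Y)) (D ×ˢ (univ : Set ℂ)) :=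
    continuousOn_snd.prodMk hc
  have hW : IsOpen ((D ×ˢ (univ : Set ℂ)) ∩
      (fun q : ℂ × ℂ => ((q.2, F q.1 q.2) : ℂ × Y)) ⁻¹' V) :=
    hg.isOpen_inter_preimage (hD.prod isOpen_univ) hV
  have hsub : ({b₁} : Set ℂ) ×ˢ Metric.closedBall (0 : ℂ) r₀ ⊆
      (D ×ˢ (univ : Set ℂ)) ∩ (fun q : ℂ × ℂ => ((q.2, F q.1 q.2) : ℂ × Y)) ⁻¹' V := by
    intro q hq
    have hq1 : q.1 = b₁ := hq.1
    refine ⟨⟨hq1 ▸ hb₁, mem_univ _⟩, ?_⟩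
    show (q.2, F q.1 q.2) ∈ V
    rw [hq1]
    exact hgraph q.2
  obtain ⟨U, W, hU, -, hbU, hballW, hUW⟩ :=
    generalized_tube_lemma isCompact_singleton (isCompact_closedBall (0 : ℂ) r₀) hW hsub
  obtain ⟨η, hη, hballU⟩ := Metric.isOpen_iff.1 hU b₁ (hbU (mem_singleton b₁))
  refine ⟨η, hη, fun b _hbD hdist ξ hξ => ?_⟩
  have hbU' : b ∈ U := hballU (Metric.mem_ball.2 hdist)
  have hξW : ξ ∈ W := hballW (Metric.mem_closedBall.2 (by rwa [dist_zero_right]))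
  exact (hUW (mk_mem_prod hbU' hξW)).2

/-- Closedness step: if for fixed `ξ` two maps `b ↦ Fᵢ b ξ` into a Hausdorff space are continuous on
`D` and agree on `E ⊆ D`, then they agree at every point of `closure E ∩ D`. -/
theorem familyUnique_closed {Y : Type*} [TopologicalSpace Y] [T2Space Y] {D E : Set ℂ}
    (hED : E ⊆ D) {g₁ g₂ : ℂ → Y} (hg₁ : ContinuousOn g₁ D) (hg₂ : ContinuousOn g₂ D)
    (hE : ∀ b ∈ E, g₁ b = g₂ b) {b : ℂ} (hbcl : b ∈ closure E) (hbD : b ∈ D) :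
    g₁ b = g₂ b := by
  haveI : (𝓝[E] b).NeBot := mem_closure_iff_nhdsWithin_neBot.1 hbcl
  have t1 : Tendsto g₁ (𝓝[E] b) (𝓝 (g₁ b)) := ((hg₁ b hbD).mono hED).tendsto
  have t2 : Tendsto g₂ (𝓝[E] b) (𝓝 (g₂ b)) := ((hg₂ b hbD).mono hED).tendsto
  have heq : g₁ =ᶠ[𝓝[E] b] g₂ := by
    filter_upwards [self_mem_nhdsWithin] with x hx
    exact hE x hx
  exact tendsto_nhds_unique_of_eventuallyEq t1 t2 heq

/-- Slice continuity: if `(b, ξ) ↦ F b ξ` is continuous on `D × ℂ`, then for fixed `ξ` the map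
`b ↦ F b ξ` is continuous on `D`. -/
theorem familyUnique_slice {Y : Type*} [TopologicalSpace Y] {D : Set ℂ} {F : ℂ → ℂ → Y}
    (hc : ContinuousOn (fun q : ℂ × ℂ => F q.1 q.2) (D ×ˢ (univ : Set ℂ))) (ξ : ℂ) :
    ContinuousOn (fun b : ℂ => F b ξ) D := by
  intro b hbD
  have hφ : ContinuousWithinAt (fun b : ℂ => ((b, ξ) : ℂ × ℂ)) D b :=
    (Continuous.prodMk_left ξ).continuousWithinAt
  have key : ContinuousWithinAt ((fun q : ℂ × ℂ => F q.1 q.2) ∘ fun b' : ℂ => ((b', ξ) : ℂ × ℂ)) D b :=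
    ContinuousWithinAt.comp (f := fun b' : ℂ => ((b', ξ) : ℂ × ℂ)) (x := b)
      (hc (b, ξ) ⟨hbD, mem_univ _⟩) hφ fun b' hb' => ⟨hb', mem_univ _⟩
  exact key

/-- **UNIQ — uniqueness of continuous families of members on connected domains** (from the
universality half of the local chart `A'` of the member moduli space, hypothesis `hA`): two families
`F₁, F₂` of pencil members over an open preconnected `D ⊆ ℂ` (`Fᵢ b` a member of intercept `b`,
`(b, ξ) ↦ Fᵢ b ξ` continuous on `D × ℂ`) which agree at one intercept agree on `D`. The coincidence
set is closed in `D` (pointwise limits in the Hausdorff space `Σ ∖ p`) and open (at a coincidence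
point `b₁` the chart of `A'` at `F₁ b₁` captures `Fᵢ b` for `b` near `b₁` — the graphs over the disc
`‖ξ‖ ≤ r₀` enter the open `V` by the generalized tube lemma — so both equal `Floc b`); conclude by
`IsPreconnected.subset_of_closure_inter_subset`. -/
theorem helper_familyUnique :
    ∀ (S : HomotopySphere 4) (p : S.carrier)
      (J : ∀ x : punctured p, TangentSpace (𝓡 4) x →L[ℝ] TangentSpace (𝓡 4) x),
      (∀ (u₀ : ℂ → punctured p) (b₀ : ℂ), IsPencilMember J u₀ b₀ →
        ∃ δ : ℝ, 0 < δ ∧ ∃ Floc : ℂ → ℂ → punctured p, Floc b₀ = u₀ ∧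
          (∀ b ∈ Metric.ball b₀ δ, IsPencilMember J (Floc b) b) ∧
          ContMDiffOn 𝓘(ℝ, ℂ × ℂ) (𝓡 4) ∞ (fun q : ℂ × ℂ => Floc q.1 q.2)
            ((Metric.ball b₀ δ) ×ˢ (univ : Set ℂ)) ∧
          (∀ q : ℂ × ℂ, q.1 ∈ Metric.ball b₀ δ →
            Function.Injective (mfderiv 𝓘(ℝ, ℂ × ℂ) (𝓡 4) (fun q : ℂ × ℂ => Floc q.1 q.2) q)) ∧
          ∃ (r₀ : ℝ) (V : Set (ℂ × punctured p)), IsOpen V ∧ (∀ ξ : ℂ, (ξ, u₀ ξ) ∈ V) ∧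
            ∀ (u : ℂ → punctured p) (b : ℂ), IsPencilMember J u b → b ∈ Metric.ball b₀ δ →
              (∀ ξ : ℂ, ‖ξ‖ ≤ r₀ → (ξ, u ξ) ∈ V) → u = Floc b) →
      ∀ (D : Set ℂ) (F₁ F₂ : ℂ → ℂ → punctured p), IsOpen D → IsPreconnected D →
        (∀ b ∈ D, IsPencilMember J (F₁ b) b) → (∀ b ∈ D, IsPencilMember J (F₂ b) b) →
        ContinuousOn (fun q : ℂ × ℂ => F₁ q.1 q.2) (D ×ˢ (univ : Set ℂ)) →
        ContinuousOn (fun q : ℂ × ℂ => F₂ q.1 q.2) (D ×ˢ (univ : Set ℂ)) →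
        (∃ b₀ ∈ D, F₁ b₀ = F₂ b₀) → ∀ b ∈ D, F₁ b = F₂ b := by
  intro S p J hA D F₁ F₂ hD hDc h1 h2 hc1 hc2 hb₀
  obtain ⟨b₀, hb₀D, hb₀⟩ := hb₀
  -- the coincidence set
  set E : Set ℂ := {b | b ∈ D ∧ F₁ b = F₂ b}
  have hED : E ⊆ D := fun b hb => hb.1
  -- `E` is closed in `D`
  have hclosed : closure E ∩ D ⊆ E := by
    rintro b ⟨hbcl, hbD⟩
    refine ⟨hbD, funext fun ξ => ?_⟩
    exact familyUnique_closed hED (familyUnique_slice hc1 ξ) (familyUnique_slice hc2 ξ)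
      (fun b' hb' => congrFun hb'.2 ξ) hbcl hbD
  -- `E` is open
  have hopen : IsOpen E := by
    rw [Metric.isOpen_iff]
    rintro b₁ ⟨hb₁D, hb₁⟩
    obtain ⟨δ, hδ, Floc, -, -, -, -, r₀, V, hV, hgraph, huniv⟩ := hA (F₁ b₁) b₁ (h1 b₁ hb₁D)
    obtain ⟨η₁, hη₁, hT₁⟩ := familyUnique_tube hD hc1 hV hb₁D hgraph r₀
    have hgraph₂ : ∀ ξ : ℂ, (ξ, F₂ b₁ ξ) ∈ V := fun ξ => by
      rw [← hb₁]
      exact hgraph ξ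
    obtain ⟨η₂, hη₂, hT₂⟩ := familyUnique_tube hD hc2 hV hb₁D hgraph₂ r₀
    obtain ⟨ρ, hρ, hballD⟩ := Metric.isOpen_iff.1 hD b₁ hb₁D
    refine ⟨min (min η₁ η₂) (min δ ρ), lt_min (lt_min hη₁ hη₂) (lt_min hδ hρ), fun b hb => ?_⟩
    rw [Metric.mem_ball] at hb
    have hη : dist b b₁ < min η₁ η₂ := lt_of_lt_of_le hb (min_le_left _ _)
    have hδρ : dist b b₁ < min δ ρ := lt_of_lt_of_le hb (min_le_right _ _)
    have hbD : b ∈ D := hballD (Metric.mem_ball.2 (lt_of_lt_of_le hδρ (min_le_right _ _)))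
    have hbδ : b ∈ Metric.ball b₁ δ := Metric.mem_ball.2 (lt_of_lt_of_le hδρ (min_le_left _ _))
    have e1 : F₁ b = Floc b :=
      huniv (F₁ b) b (h1 b hbD) hbδ (hT₁ b hbD (lt_of_lt_of_le hη (min_le_left _ _)))
    have e2 : F₂ b = Floc b :=
      huniv (F₂ b) b (h2 b hbD) hbδ (hT₂ b hbD (lt_of_lt_of_le hη (min_le_right _ _)))
    exact ⟨hbD, e1.trans e2.symm⟩
  -- clopen argument
  have hsub : D ⊆ E :=
    hDc.subset_of_closure_inter_subset hopen ⟨b₀, hb₀D, hb₀D, hb₀⟩ hclosed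
  intro b hb
  exact (hsub hb).2

end Summit.SmoothPoincare4.SmoothPoincare4.Theorems.WitnessCharge.PencilIncompleteness
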